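import Summits.QuantumFields.YangMills.Theorems.FluctuationComparisonRegPrIntLS1aCutTowerGaugeInvariant
import HarnessLib

/-!
# S1a · UV3-NODE §69.16″ — THE (m)-DOOR OF RECORD FOR THE LINE'S TOWER WITH THE `hcinv` LETTER GONE (✓p828515 ∘ ✓p829409), and its edition for the line's own
# (½, 24∕25) cut with NO hypothesis on the cut at all

Cell `ym3-torus` (YM ladder rung R3 = continuum `SU(2)` Yang–Mills on the three-torus — a RUNG: NOT d = 4, NOT infinite volume, NOT a mass gap, NOT Clay).
Width seat «width 20» `ym3-torus-px20` (gen 23), FREE px helper on crux `stmt-QuantumFields-20520`, count-neutral, DEFINITION-FREE, default heartbeats; filed on the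
S1aᴴ (m)-door lineage's word (px8 g25 2026-08-31 17:32:54Z «GO px20 — file … yourself»).

WHAT.  px8 g24's ✓p828515 `exists_admissible_schedule_memOfRun_tower` gives, for ONE admissible schedule, `∃ κ, MemOfRun … (e^κ·ρᶜ_j)` at every height of every cut-and-anchored
tower of S1aᴴ from: the (α)-package, four binders + LF clause, the cut-height letter `hdom_j`, AND `hcinv` (a.e. gauge invariance of the cut density).  ✓p829409 proved `hcinv` from the
tower's definition plus gauge invariance of the cut weights.  This file composes the two:
* ★★★ `exists_admissible_schedule_memOfRun_tower_of_invariantCut` — ✓p828515's statement with `hcinv` replaced by `hχinv : ∀ j u U, χ j (u • U) = χ j U`;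
* ★★★ `exists_admissible_schedule_memOfRun_tower_sfCut` — the edition for the line's own cut `χ j U := ∏_p max 0 (min 1 ((24∕25·θ_j − dist1 U(∂p))∕((24∕25 − ½)·θ_j)))`
  (`θ_j = θBal F.L γ b₀ p₀ j`; `hμ2` in ✓`…S1aTowerSfCutDock.exists_densities_sfCut`'s VERBATIM shape): BOTH cut letters (`χ ≤ 1`, gauge invariance) discharged
  (`sfCut2425_le_one`, ✓`sfCut2425_gaugeAct`), so the door's hypothesis list is exactly {(α)-package + `hlowc`∕`hupc`∕`hRegClass`∕`hlfle`∕`hlarge`, `hdom_j`, numerics of `Δ`}.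
CAVEAT (px8 g25 FINDING, UV3-NODE §69.17, GUIDANCE-grade exact linear algebra for the linearised one-step model): for the line's (½, 24∕25) cut the letter `hdom_j` at the
CUT heights `j < Ts` is UNSATISFIABLE for rough admissible window data — the one-step minimiser of a coarse datum inside the admissible window has finer plaquettes up to
`c(L)·2θ_j∕L²` with `c(3) = 8.56`, `c(5) = 11.90`, `c(7) = 13.25`, far outside the cut's `½θ_{j+1}` support, and at `L = 3` a feasibility LP makes the cut fibre EMPTY on an
open set of window data.  So ✓p828170 ∕ ✓p828515 ∕ this file are correct IMPLICATIONS whose cut-height letter the line's current cut profile cannot meet; the repair (cut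
profile ∕ window nesting, «W-GUARD») is a LINE-level decision, not this file's.  Nothing here asserts the satisfiability of any letter.
HONEST FRAMING: a composition of landed doors; nothing of Bałaban's analysis asserted or proved; S1aᴴ (m)∕(a) OPEN; 20520 ∕ `YM3TorusSU2` NOT proved.  Sorry-free.
-/

set_option autoImplicit false

noncomputable section

namespace Summit.QuantumFields.YangMills.Theorems.FluctuationComparisonRegPrIntLS1aAlphaMemOfRunTowerInvariantCut

open MeasureTheory Set
open scoped ENNReal
open Literature.MathematicalPhysics.QuantumFieldTheory.Balaban1983to89
open T3ContinuumYM3Torus T3UnitScaleTilt T3UnitLawDensityEML T3RestrictedUnitDensity T3AlphaInputsAC T3AlphaInputsACSchemas T3AlphaInputsACTrivRows BalabanUVClass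
open T3NestedUnitLaws (descend)
open Literature.MathematicalPhysics.QuantumFieldTheory.Balaban1983to89.Missing (partitionFn)
open Summit.QuantumFields.YangMills.Theorems.FluctuationComparisonRegPrIntLS1aAlphaMemOfRunTower
open Summit.QuantumFields.YangMills.Theorems.FluctuationComparisonRegPrIntLS1aCutTowerGaugeInvariant

variable {F : T3Family} {γ : ℝ}

/-- ★★★ **THE (m)-DOOR OF RECORD FOR THE TOWER, `hcinv` GONE**: ✓p828515 `exists_admissible_schedule_memOfRun_tower` — statement byte-identical except that the binder
`(∀ g, (fun V => ρᶜ (g • V)) =ᵐ[dU] ρᶜ) →` is DELETED and `(∀ j u U, χ j (u • U) = χ j U) →` (gauge invariance of the cut WEIGHTS) is INSERTED after `hχ1`; the deleted letter is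
supplied inside by ✓p829409 `cutTower_density_ae_gaugeInvariant`.  An IMPLICATION: its letters (the (α)-package fields, `hdom_j`, …) are hypotheses, not claims (see the
module docstring's caveat on `hdom_j`). [cite: Balaban1985UV3, (41)-(47) pp.266-267, (2) p.256, (6) p.257] -/
theorem exists_admissible_schedule_memOfRun_tower_of_invariantCut {D : AlphaDataT3 F γ} (W : LFData D) {b₀ p₀ ε₀ C68 Cχ B₃ r CD R₀ C₅ : ℝ} {M₁ : ℕ}
    (h : AlphaInputsT3ACFullTriv D W b₀ p₀ ε₀ C68 Cχ B₃ M₁ r CD) (hγ : 0 < γ) (hγ1 : γ ≤ 1) (hγe : Real.sqrt γ ≤ Real.exp (1 - p₀)) (hb : 0 ≤ b₀) (hp : 0 ≤ p₀)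
    (hr : 0 ≤ r) (hM1 : 1 ≤ M₁) (hMdvd : M₁ ∣ 2 * F.L ^ F.m) (hCD : 0 ≤ CD) (hR₀ : 0 < R₀)
    (Δ : ℕ → ℝ) {S₁ q₁ : ℝ} (hq₁0 : 0 ≤ q₁) (hq₁1 : q₁ < 1) (hΔ0 : ∀ j, 0 ≤ Δ j) (hΔ : ∀ j, Δ j ≤ S₁ * q₁ ^ j) :
    ∃ prm : ℕ → ClassParams, AdmissibleClassParams F γ (b₀ / 2) p₀ prm ∧
      (∀ n, (prm n).δ = θBal F.L γ b₀ p₀ n ∧ (prm n).δreg = R₀ ∧ (prm n).δL = θBal F.L γ b₀ p₀ n ∧ (prm n).β = (F.L : ℝ) ^ n / γ ∧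
        (prm n).cLF = B10.pFun (b₀ / 2) p₀ (Real.sqrt (γ * ((F.L : ℝ)⁻¹) ^ n)) ^ 2 / 4 ∧ (prm n).c5 = C₅ ∧ (prm n).cE = 0) ∧
      ∀ (ν : ℕ → (j : ℕ) → Measure (GaugeField (F.P j) 0 (Matrix.specialUnitaryGroup (Fin 2) ℂ))),
        (∀ K, ν K K = T4GenFunBounds.gibbsMeasure (F.P K) ((F.scheme ℰp γ).β K)) →
        (∀ K j, j < K → ν K j = Measure.map (descend F ℰp j) (ν K (j + 1))) →
        ∀ (K Ts : ℕ), Ts ≤ K → ∀ (μ : (j : ℕ) → Measure (GaugeField (F.P j) 0 (Matrix.specialUnitaryGroup (Fin 2) ℂ)))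
          (χ : (j : ℕ) → GaugeField (F.P j) 0 (Matrix.specialUnitaryGroup (Fin 2) ℂ) → ℝ), (∀ j U, χ j U ≤ 1) →
          (∀ (j : ℕ) (u : GaugeTransf (F.P j) 0 (Matrix.specialUnitaryGroup (Fin 2) ℂ)) (U : GaugeField (F.P j) 0 (Matrix.specialUnitaryGroup (Fin 2) ℂ)),
            χ j (GaugeField.gaugeAct u U) = χ j U) →
          (∀ j, Ts ≤ j → μ j = ν K j) →
          (∀ j, j < Ts → μ j = Measure.map (descend F ℰp j) ((μ (j + 1)).withDensity fun U => ENNReal.ofReal (χ (j + 1) U))) →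
        ∀ (j : ℕ) (hjK : j ≤ K) (ρc ρt : GaugeField (F.P j) 0 (Matrix.specialUnitaryGroup (Fin 2) ℂ) → ℝ),
          Continuous ρc → Continuous ρt → (∀ V, 0 ≤ ρc V) → (∀ V, 0 ≤ ρt V) →
          μ j = (fieldMeasure (F.P j) 0 (Matrix.specialUnitaryGroup (Fin 2) ℂ)).withDensity (fun V => ENNReal.ofReal (ρc V)) →
          ν K j = (fieldMeasure (F.P j) 0 (Matrix.specialUnitaryGroup (Fin 2) ℂ)).withDensity (fun V => ENNReal.ofReal (ρt V)) →
          ContinuousOn (D.low K (K - j)) {V | PlaqSmall (θBal F.L γ b₀ p₀ j) V} →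
          ContinuousOn (D.up K (K - j)) {V | PlaqSmall (θBal F.L γ b₀ p₀ j) V} →
          (∀ V : GaugeField (F.P K) (K - j) (Matrix.specialUnitaryGroup (Fin 2) ℂ), PlaqSmall (θBal F.L γ b₀ p₀ j) V →
            IsBackground (fun i => BlockAveraging.blockAvg (P := F.P K) (j := i) ℰp) {U | PlaqSmall R₀ U} (K - j) V (D.Umin K (K - j) (D.triv K (K - j)) V)) →
          (∀ V : GaugeField (F.P K) (K - j) (Matrix.specialUnitaryGroup (Fin 2) ℂ),
            Real.exp (D.Ecst K (K - j)) * (Real.exp (-(D.Ecst K (K - j)) + D.Rm K (K - j)) * (D.up K (K - j) V - D.low K (K - j) V)) ≤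
              Real.exp (-(prm j).cLF) * Real.exp (C₅ * Fintype.card (Site (F.P K) (K - j)))) →
          (∀ (V : GaugeField (F.P K) (K - j) (Matrix.specialUnitaryGroup (Fin 2) ℂ)) (S : Finset (Plaq (F.P K) (K - j))),
            (∀ p ∈ S, θBal F.L γ b₀ p₀ j ≤ GaugeGroup.dist1 (GaugeField.plaqHol V p)) →
              Real.exp (D.Ecst K (K - j)) * (partitionFn (G := Matrix.specialUnitaryGroup (Fin 2) ℂ) (F.P K) ((F.scheme ℰp γ).β K) * readAtLevel F hjK ρt V) ≤
                Real.exp (-((prm j).cLF * S.card)) * Real.exp (C₅ * Fintype.card (Site (F.P K) (K - j)))) →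
          (∀ V : GaugeField (F.P K) (K - j) (Matrix.specialUnitaryGroup (Fin 2) ℂ), PlaqSmall (θBal F.L γ b₀ p₀ j) V →
            readAtLevel F hjK ρt V ≤ Real.exp (Δ j) * readAtLevel F hjK ρc V) →
          ∃ κ : ℝ, MemOfRun F ℰp hjK { prm j with β := (F.scheme ℰp γ).β K } (fun V => Real.exp κ * ρc V) := by
  obtain ⟨prm, hadm, hfields, hmem⟩ := exists_admissible_schedule_memOfRun_tower (F := F) W h hγ hγ1 hγe hb hp hr hM1 hMdvd hCD hR₀ Δ hq₁0 hq₁1 hΔ0 hΔ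
  refine ⟨prm, hadm, hfields, ?_⟩
  intro ν hν1 hν2 K Ts hTs μ χ hχ1 hχinv hμ1 hμ2 j hjK ρc ρt hcc htc hc0 ht0 hμc hνt hlowc hupc hRegClass hlfle hlarge hdom
  exact hmem ν hν1 hν2 K Ts hTs μ χ hχ1 hμ1 hμ2 j hjK ρc ρt hcc htc hc0 ht0 hμc hνt
    (cutTower_density_ae_gaugeInvariant F hγ.le ν hν1 hν2 hTs μ χ hχinv hμ1 hμ2 hjK hcc hc0 hμc) hlowc hupc hRegClass hlfle hlarge hdom

/-- **The (½, 24∕25) cut term is at most one.** [cite: Balaban1985UV3, (7) p.257] -/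
theorem sfCut2425_le_one {P : Params} {k : ℕ} (θ : ℝ) (U : GaugeField P k (Matrix.specialUnitaryGroup (Fin 2) ℂ)) :
    (∏ p : Plaq P k, max 0 (min 1 ((24 / 25 * θ - dist1 (GaugeField.plaqHol U p)) / ((24 / 25 - 1 / 2) * θ)))) ≤ 1 :=
  Finset.prod_le_one (fun _ _ => le_max_left _ _) fun _ _ => max_le zero_le_one (min_le_left _ _)

/-- ★★★ **THE (m)-DOOR FOR THE LINE'S OWN (½, 24∕25) CUT, NO HYPOTHESIS ON THE CUT**: as `exists_admissible_schedule_memOfRun_tower_of_invariantCut` with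
`χ j U := ∏_p max 0 (min 1 ((24∕25·θ_j − dist1 U(∂p))∕((24∕25 − ½)·θ_j)))`, `θ_j = θBal F.L γ b₀ p₀ j` — `χ ≤ 1` and gauge invariance discharged (`sfCut2425_le_one`,
✓`sfCut2425_gaugeAct`); `hμ2` in ✓`…S1aTowerSfCutDock.exists_densities_sfCut`'s shape.  An IMPLICATION (caveat on `hdom_j` in the module docstring).
[cite: Balaban1985UV3, (7) p.257, (41)-(47) pp.266-267] -/
theorem exists_admissible_schedule_memOfRun_tower_sfCut {D : AlphaDataT3 F γ} (W : LFData D) {b₀ p₀ ε₀ C68 Cχ B₃ r CD R₀ C₅ : ℝ} {M₁ : ℕ}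
    (h : AlphaInputsT3ACFullTriv D W b₀ p₀ ε₀ C68 Cχ B₃ M₁ r CD) (hγ : 0 < γ) (hγ1 : γ ≤ 1) (hγe : Real.sqrt γ ≤ Real.exp (1 - p₀)) (hb : 0 ≤ b₀) (hp : 0 ≤ p₀)
    (hr : 0 ≤ r) (hM1 : 1 ≤ M₁) (hMdvd : M₁ ∣ 2 * F.L ^ F.m) (hCD : 0 ≤ CD) (hR₀ : 0 < R₀)
    (Δ : ℕ → ℝ) {S₁ q₁ : ℝ} (hq₁0 : 0 ≤ q₁) (hq₁1 : q₁ < 1) (hΔ0 : ∀ j, 0 ≤ Δ j) (hΔ : ∀ j, Δ j ≤ S₁ * q₁ ^ j) :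
    ∃ prm : ℕ → ClassParams, AdmissibleClassParams F γ (b₀ / 2) p₀ prm ∧
      (∀ n, (prm n).δ = θBal F.L γ b₀ p₀ n ∧ (prm n).δreg = R₀ ∧ (prm n).δL = θBal F.L γ b₀ p₀ n ∧ (prm n).β = (F.L : ℝ) ^ n / γ ∧
        (prm n).cLF = B10.pFun (b₀ / 2) p₀ (Real.sqrt (γ * ((F.L : ℝ)⁻¹) ^ n)) ^ 2 / 4 ∧ (prm n).c5 = C₅ ∧ (prm n).cE = 0) ∧
      ∀ (ν : ℕ → (j : ℕ) → Measure (GaugeField (F.P j) 0 (Matrix.specialUnitaryGroup (Fin 2) ℂ))),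
        (∀ K, ν K K = T4GenFunBounds.gibbsMeasure (F.P K) ((F.scheme ℰp γ).β K)) →
        (∀ K j, j < K → ν K j = Measure.map (descend F ℰp j) (ν K (j + 1))) →
        ∀ (K Ts : ℕ), Ts ≤ K → ∀ (μ : (j : ℕ) → Measure (GaugeField (F.P j) 0 (Matrix.specialUnitaryGroup (Fin 2) ℂ))),
          (∀ j, Ts ≤ j → μ j = ν K j) →
          (∀ j, j < Ts → μ j = Measure.map (descend F ℰp j) ((μ (j + 1)).withDensity (fun U => ENNReal.ofReal
            (∏ p : Plaq (F.P (j + 1)) 0, max 0 (min 1 ((24 / 25 * θBal F.L γ b₀ p₀ (j + 1) - dist1 (GaugeField.plaqHol U p)) /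
              ((24 / 25 - 1 / 2) * θBal F.L γ b₀ p₀ (j + 1)))))))) →
        ∀ (j : ℕ) (hjK : j ≤ K) (ρc ρt : GaugeField (F.P j) 0 (Matrix.specialUnitaryGroup (Fin 2) ℂ) → ℝ),
          Continuous ρc → Continuous ρt → (∀ V, 0 ≤ ρc V) → (∀ V, 0 ≤ ρt V) →
          μ j = (fieldMeasure (F.P j) 0 (Matrix.specialUnitaryGroup (Fin 2) ℂ)).withDensity (fun V => ENNReal.ofReal (ρc V)) →
          ν K j = (fieldMeasure (F.P j) 0 (Matrix.specialUnitaryGroup (Fin 2) ℂ)).withDensity (fun V => ENNReal.ofReal (ρt V)) →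
          ContinuousOn (D.low K (K - j)) {V | PlaqSmall (θBal F.L γ b₀ p₀ j) V} →
          ContinuousOn (D.up K (K - j)) {V | PlaqSmall (θBal F.L γ b₀ p₀ j) V} →
          (∀ V : GaugeField (F.P K) (K - j) (Matrix.specialUnitaryGroup (Fin 2) ℂ), PlaqSmall (θBal F.L γ b₀ p₀ j) V →
            IsBackground (fun i => BlockAveraging.blockAvg (P := F.P K) (j := i) ℰp) {U | PlaqSmall R₀ U} (K - j) V (D.Umin K (K - j) (D.triv K (K - j)) V)) →
          (∀ V : GaugeField (F.P K) (K - j) (Matrix.specialUnitaryGroup (Fin 2) ℂ),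
            Real.exp (D.Ecst K (K - j)) * (Real.exp (-(D.Ecst K (K - j)) + D.Rm K (K - j)) * (D.up K (K - j) V - D.low K (K - j) V)) ≤
              Real.exp (-(prm j).cLF) * Real.exp (C₅ * Fintype.card (Site (F.P K) (K - j)))) →
          (∀ (V : GaugeField (F.P K) (K - j) (Matrix.specialUnitaryGroup (Fin 2) ℂ)) (S : Finset (Plaq (F.P K) (K - j))),
            (∀ p ∈ S, θBal F.L γ b₀ p₀ j ≤ GaugeGroup.dist1 (GaugeField.plaqHol V p)) →
              Real.exp (D.Ecst K (K - j)) * (partitionFn (G := Matrix.specialUnitaryGroup (Fin 2) ℂ) (F.P K) ((F.scheme ℰp γ).β K) * readAtLevel F hjK ρt V) ≤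
                Real.exp (-((prm j).cLF * S.card)) * Real.exp (C₅ * Fintype.card (Site (F.P K) (K - j)))) →
          (∀ V : GaugeField (F.P K) (K - j) (Matrix.specialUnitaryGroup (Fin 2) ℂ), PlaqSmall (θBal F.L γ b₀ p₀ j) V →
            readAtLevel F hjK ρt V ≤ Real.exp (Δ j) * readAtLevel F hjK ρc V) →
          ∃ κ : ℝ, MemOfRun F ℰp hjK { prm j with β := (F.scheme ℰp γ).β K } (fun V => Real.exp κ * ρc V) := by
  obtain ⟨prm, hadm, hfields, hmem⟩ :=
    exists_admissible_schedule_memOfRun_tower_of_invariantCut (F := F) W h hγ hγ1 hγe hb hp hr hM1 hMdvd hCD hR₀ Δ hq₁0 hq₁1 hΔ0 hΔ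
  refine ⟨prm, hadm, hfields, ?_⟩
  intro ν hν1 hν2 K Ts hTs μ hμ1 hμ2
  exact hmem ν hν1 hν2 K Ts hTs μ
    (fun i U => ∏ p : Plaq (F.P i) 0, max 0 (min 1 ((24 / 25 * θBal F.L γ b₀ p₀ i - dist1 (GaugeField.plaqHol U p)) /
      ((24 / 25 - 1 / 2) * θBal F.L γ b₀ p₀ i))))
    (fun i U => sfCut2425_le_one _ U) (fun _ u U => sfCut2425_gaugeAct _ u U) hμ1 hμ2

end Summit.QuantumFields.YangMills.Theorems.FluctuationComparisonRegPrIntLS1aAlphaMemOfRunTowerInvariantCut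

end
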